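import Summits.ValiantsHypothesis.ValiantsHypothesis.Theorems.NewtonUnitEquationsTwoProductsExpBlockTensorCoeff
import Summits.ValiantsHypothesis.ValiantsHypothesis.Theorems.NewtonUnitEquationsTwoProductsFormalLogLinearisationStubLogLinearisation
import Summits.ValiantsHypothesis.ValiantsHypothesis.Theorems.NewtonUnitEquationsTwoProductsFormalLogLinearisationEngineCommonConeLattice

/-!
# K10 `exp-block-tensorisation` — L2 PROVED (`expTensorVisible_holds`) and the UNCONDITIONAL quasi-polynomial corollary `blockGradedQuasiPoly_holds`

K10c, second half (val-idea-crit-8 g2's queue 20:38:11Z).  From L1 (`expTensorCoeff_holds`): (a) a visible point `l` of the log-sum lies in the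
support of `∏(1+u) − ∏(1+v)` (landed `stub_logLinearisation`), hence is the point of a non-zero multiset of `≤ m` letters, so L1 gives
`coeff_l 𝒲 ≠ 0`; (b) every support point of `𝒲` is the point of a non-zero multiset with `≤ m` letters per block (L3's frame bookkeeping), so L1
gives `supp 𝒲 ⊆ supp D`; (c) a strict `ξ`-top of a finite planar set is an extreme point of its convex hull (`wt_strictTop_mem_extremePoints`, the planar
case of the folklore strict-separation lemma; the landed general form lives in a route-dependent Negative file and is not imported).  COROLLARY OF RECORD: `blockGradedQuasiPoly_holds : BlockGradedQuasiPoly :=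
blockGradedQuasiPoly_of expTensorVisible_holds expTensorFrames_holds` — on a block-graded alphabet with `b` blocks and block frames of size `≤ s` every
cell family has `≤ (s+2)·(8(2m+2)³)^⌈log₂ b⌉` points (val-idea-37 g2's K10 target; Theorem Q of the sibling crux stmt-5905 does the counting).
Helper mode (`--supports stmt-ValiantsHypothesis-5906 --as helper`).  HONEST LABEL: a proper positive sub-case (block-GRADED alphabets); the natural
SHALLOW hypothesis (P1 `ShallowQ`) is NOT claimed; nothing here closes 5906 or 5905 (`TwoProducts` / `ResidualLawV23` / `PlanarCellBound` /
`DissociatedUniform` OPEN); VP ≠ VNP is NOT proved.  No instances, no notation, no named facts. [folklore]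
-/

noncomputable section
set_option linter.dupNamespace false

namespace Summit.ValiantsHypothesis.ValiantsHypothesis.Theorems.NewtonUnitEquations.TwoProducts.ExpBlock

open MvPolynomial Finset
open Summit.ValiantsHypothesis.ValiantsHypothesis.Theorems.NewtonUnitEquations.TwoProducts.FormalLogLinearisation
open Summit.ValiantsHypothesis.ValiantsHypothesis.Theorems.NewtonUnitEquations.TwoProducts.PlanarCell

variable {m b : ℕ}

/-! ## Representing multisets -/

/-- Dropping the zeros of a multiset of exponents does not change its sum. [folklore] -/
theorem sum_filter_ne_zero (s : Multiset Expo) : (s.filter (fun e => e ≠ 0)).sum = s.sum := by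
  classical
  conv_rhs => rw [← Multiset.filter_add_not (fun e => e ≠ 0) s]
  rw [Multiset.sum_add]
  have : (s.filter (fun e => ¬ e ≠ 0)).sum = 0 := Multiset.sum_eq_zero fun e he => by
    have := (Multiset.mem_filter.1 he).2
    push Not at this
    exact this
  rw [this, add_zero]

/-- A support point of `∏_j (1 + w_j)` is the point of a multiset of at most `m` letters of any letter set containing the supports. [folklore] -/
theorem exists_multiset_of_mem_support_prod_one_add (w : Fin m → MvPolynomial (Fin 2) ℂ) (A : Finset Expo)
    (hwA : ∀ j, (w j).support ⊆ A) (l : Expo) (hl : l ∈ (∏ j, (1 + w j)).support) :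
    ∃ k : Multiset Expo, (∀ e ∈ k, e ∈ A) ∧ Multiset.card k ≤ m ∧ k.sum = l := by
  classical
  obtain ⟨g, hg0, -, hgsum⟩ := support_prod_one_add w Finset.univ l hl
  refine ⟨((Finset.univ : Finset (Fin m)).val.map g).filter (fun e => e ≠ 0), ?_, ?_, ?_⟩
  · intro e he
    obtain ⟨he', hne⟩ := Multiset.mem_filter.1 he
    obtain ⟨i, -, rfl⟩ := Multiset.mem_map.1 he'
    exact hwA i ((Finset.mem_insert.1 (hg0 i)).resolve_left hne)
  · calc Multiset.card (((Finset.univ : Finset (Fin m)).val.map g).filter (fun e => e ≠ 0))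
        ≤ Multiset.card ((Finset.univ : Finset (Fin m)).val.map g) := Multiset.card_le_card (Multiset.filter_le _ _)
      _ = m := by simp
  · rw [sum_filter_ne_zero, ← Finset.sum_eq_multiset_sum, hgsum]

/-- A support point of `∏(1+u) − ∏(1+v)` is the point of a multiset of at most `m` letters. [folklore] -/
theorem exists_multiset_of_mem_support_tailDiff (u v : Fin m → MvPolynomial (Fin 2) ℂ) (A : Finset Expo)
    (huA : ∀ j, (u j).support ⊆ A) (hvA : ∀ j, (v j).support ⊆ A) (l : Expo) (hl : l ∈ (tailDiff u v).support) :
    ∃ k : Multiset Expo, (∀ e ∈ k, e ∈ A) ∧ Multiset.card k ≤ m ∧ k.sum = l := by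
  classical
  unfold tailDiff at hl
  rcases Finset.mem_union.1 (support_sub _ _ _ hl) with h | h
  · exact exists_multiset_of_mem_support_prod_one_add u A huA l h
  · exact exists_multiset_of_mem_support_prod_one_add v A hvA l h

/-- The constant term of a product of block truncated exponentials of a tail is `1`. [folklore] -/
theorem coeff_zero_prod_truncExp (blk : Expo → Fin b) (M : ℕ) {q : MvPolynomial (Fin 2) ℂ} (hq : coeff 0 q = 0) :
    coeff 0 (∏ B, truncExp M (restrictBlock blk B q)) = 1 := by
  have h : ∀ B, constantCoeff (truncExp M (restrictBlock blk B q)) = 1 := fun B => by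
    rw [constantCoeff_eq]
    exact coeff_zero_truncExp M (coeff_zero_restrictBlock blk B hq)
  have key : constantCoeff (∏ B, truncExp M (restrictBlock blk B q)) = 1 := by
    rw [map_prod]
    exact Finset.prod_eq_one fun B _ => h B
  rwa [constantCoeff_eq] at key

/-- The exponential block tensor has no constant term. [folklore] -/
theorem coeff_zero_expTensor (blk : Expo → Fin b) (u v : Fin m → MvPolynomial (Fin 2) ℂ) (hu0 : ∀ j, coeff 0 (u j) = 0)
    (hv0 : ∀ j, coeff 0 (v j) = 0) : coeff 0 (expTensor blk u v) = 0 := by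
  unfold expTensor
  rw [coeff_sub, coeff_sum, coeff_sum]
  simp_rw [coeff_zero_prod_truncExp blk m (hu0 _), coeff_zero_prod_truncExp blk m (hv0 _)]
  simp

/-- A support point of the exponential block tensor is the point of a NON-ZERO multiset of letters with at most `m` letters per block.
[folklore] -/
theorem exists_multiset_of_mem_support_expTensor (blk : Expo → Fin b) (u v : Fin m → MvPolynomial (Fin 2) ℂ) (A : Finset Expo)
    (hu : ∀ j, coeff 0 (u j) = 0 ∧ (u j).support ⊆ A) (hv : ∀ j, coeff 0 (v j) = 0 ∧ (v j).support ⊆ A)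
    (p : Expo) (hp : p ∈ (expTensor blk u v).support) :
    ∃ k : Multiset Expo, (∀ e ∈ k, e ∈ A) ∧ (∀ B, Multiset.card (k.filter (fun e => blk e = B)) ≤ m) ∧ k.sum = p ∧ k ≠ 0 := by
  classical
  have hp0 : p ≠ 0 := by
    rintro rfl
    exact (mem_support_iff.1 hp) (coeff_zero_expTensor blk u v (fun j => (hu j).1) (fun j => (hv j).1))
  -- a support point of one of the `2m` products
  have key : ∀ w : Fin m → MvPolynomial (Fin 2) ℂ, (∀ j, (w j).support ⊆ A) → ∀ j,
      p ∈ (∏ B, truncExp m (restrictBlock blk B (w j))).support →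
      ∃ k : Multiset Expo, (∀ e ∈ k, e ∈ A) ∧ (∀ B, Multiset.card (k.filter (fun e => blk e = B)) ≤ m) ∧ k.sum = p := by
    intro w hw j hpj
    obtain ⟨d, hd, hds⟩ := exists_of_mem_support_prod Finset.univ _ _ hpj
    have hd' : ∀ B, d B ∈ blockFrame A blk m B := fun B =>
      support_truncExp_subset A blk m B _ (support_restrictBlock_subset blk B (w j) A (hw j)) (hd B (Finset.mem_univ B))
    obtain ⟨k, hkA, hkm, -, hks⟩ := exists_multiset_of_blockTuple A blk m d hd'
    exact ⟨k, hkA, hkm, by rw [hks, hds]⟩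
  have hex : ∃ k : Multiset Expo, (∀ e ∈ k, e ∈ A) ∧ (∀ B, Multiset.card (k.filter (fun e => blk e = B)) ≤ m) ∧ k.sum = p := by
    unfold expTensor at hp
    rcases Finset.mem_union.1 (support_sub _ _ _ hp) with h | h
    · obtain ⟨j, -, hj⟩ := Finset.mem_biUnion.1 (support_sum h)
      exact key u (fun j => (hu j).2) j hj
    · obtain ⟨j, -, hj⟩ := Finset.mem_biUnion.1 (support_sum h)
      exact key v (fun j => (hv j).2) j hj
  obtain ⟨k, hkA, hkm, hks⟩ := hex
  refine ⟨k, hkA, hkm, hks, ?_⟩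
  rintro rfl
  exact hp0 (by rw [← hks, Multiset.sum_zero])

/-! ## Strict tops are vertices (planar strict separation) -/

/-- **A strict `ξ`-top of a finite set of exponents is an extreme point of the convex hull of its real image** (strict separation by the
linear functional `y ↦ ξ₀ y₀ + ξ₁ y₁`; the convex set `{cast l} ∪ {L < L (cast l)}` contains the hull). [folklore] -/
theorem wt_strictTop_mem_extremePoints (ξ : Fin 2 → ℝ) (S : Finset Expo) (l : Expo) (hlS : l ∈ S)
    (hlt : ∀ p ∈ S, p ≠ l → wt ξ p < wt ξ l) :
    (fun i : Fin 2 => ((l i : ℕ) : ℝ)) ∈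
      Set.extremePoints ℝ (convexHull ℝ ((fun e : Expo => fun i : Fin 2 => ((e i : ℕ) : ℝ)) '' (S : Set Expo))) := by
  classical
  set cast : Expo → (Fin 2 → ℝ) := fun e i => ((e i : ℕ) : ℝ) with hcast
  set L : (Fin 2 → ℝ) →ₗ[ℝ] ℝ := ξ 0 • LinearMap.proj 0 + ξ 1 • LinearMap.proj 1 with hLdef
  have hL : ∀ e : Expo, L (cast e) = wt ξ e := fun e => by simp [L, cast, wt]
  set x := cast l with hx
  -- the convex set `B = {x} ∪ {L < L x}` contains the image of `S`
  set B : Set (Fin 2 → ℝ) := {y | y = x ∨ L y < L x} with hB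
  have hBconv : Convex ℝ B := by
    intro y₁ hy₁ y₂ hy₂ a b ha hb hab
    have hval : L (a • y₁ + b • y₂) = a * L y₁ + b * L y₂ := by simp [map_add, map_smul, smul_eq_mul]
    have h2 : L y₂ ≤ L x := by
      rcases hy₂ with h | h
      · rw [h]
      · exact h.le
    by_cases ha0 : a = 0
    · subst ha0
      simp only [zero_add] at hab
      subst hab
      simpa using hy₂
    by_cases hb0 : b = 0
    · subst hb0
      simp only [add_zero] at hab
      subst hab
      simpa using hy₁
    have hapos : 0 < a := lt_of_le_of_ne ha (Ne.symm ha0)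
    have hbpos : 0 < b := lt_of_le_of_ne hb (Ne.symm hb0)
    rcases hy₁ with hy₁ | hy₁
    · rcases hy₂ with hy₂ | hy₂
      · left
        rw [hy₁, hy₂, ← add_smul, hab, one_smul]
      · right
        rw [hval, hy₁]
        have e2 : b * L y₂ < b * L x := mul_lt_mul_of_pos_left hy₂ hbpos
        have e1 : a * L x + b * L x = L x := by rw [← add_mul, hab, one_mul]
        linarith
    · right
      rw [hval]
      have e2 : a * L y₁ < a * L x := mul_lt_mul_of_pos_left hy₁ hapos
      have e3 : b * L y₂ ≤ b * L x := mul_le_mul_of_nonneg_left h2 hb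
      have e1 : a * L x + b * L x = L x := by rw [← add_mul, hab, one_mul]
      linarith
  have hSB : cast '' (S : Set Expo) ⊆ B := by
    rintro _ ⟨p, hp, rfl⟩
    by_cases h : p = l
    · exact Or.inl (by rw [h])
    · right
      rw [hL, hx, hL]
      exact hlt p (Finset.mem_coe.1 hp) h
  have hconvB : convexHull ℝ (cast '' (S : Set Expo)) ⊆ B := convexHull_min hSB hBconv
  rw [mem_extremePoints]
  refine ⟨subset_convexHull ℝ _ ⟨l, Finset.mem_coe.2 hlS, rfl⟩, ?_⟩
  intro x₁ hx₁ x₂ hx₂ hxseg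
  obtain ⟨a, b, ha, hb, hab, hcomb⟩ := hxseg
  have hxeq : a • x₁ + b • x₂ = x := hcomb
  have key : L x = a * L x₁ + b * L x₂ := by
    rw [← hxeq]
    simp [map_add, map_smul, smul_eq_mul]
  have h1 := hconvB hx₁
  have h2 := hconvB hx₂
  have hl1 : L x₁ ≤ L x := by
    rcases h1 with h | h
    · rw [h]
    · exact h.le
  have hl2 : L x₂ ≤ L x := by
    rcases h2 with h | h
    · rw [h]
    · exact h.le
  have e1 : a * L x + b * L x = L x := by rw [← add_mul, hab, one_mul]
  constructor
  · rcases h1 with h | h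
    · exact h
    · exfalso
      have e2 : a * L x₁ < a * L x := mul_lt_mul_of_pos_left h ha
      have e3 : b * L x₂ ≤ b * L x := mul_le_mul_of_nonneg_left hl2 hb.le
      linarith
  · rcases h2 with h | h
    · exact h
    · exfalso
      have e2 : b * L x₂ < b * L x := mul_lt_mul_of_pos_left h hb
      have e3 : a * L x₁ ≤ a * L x := mul_le_mul_of_nonneg_left hl1 ha.le
      linarith

/-! ## L2 and the corollary -/

/-- **K10 L2 — `expTensorVisible_holds : ExpTensorVisible`** (val-idea-37 g2's L2, text in `…ExpBlockTensor`): on a block-graded alphabet every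
visible point of the log-sum (every point of every cell family) is a vertex of the Newton polytope of the exponential block tensor. [folklore] -/
theorem expTensorVisible_holds : ExpTensorVisible := by
  intro m b u v A blk hu hv hG ξ l hξ hl
  classical
  have hu0 : ∀ j, coeff 0 (u j) = 0 := fun j => (hu j).1
  have hv0 : ∀ j, coeff 0 (v j) = 0 := fun j => (hv j).1
  -- (a) `l` is a support point of `𝒲`
  have hlD : logDiff u v l ≠ 0 := hl.1
  have hlT : l ∈ (tailDiff u v).support := Finset.mem_coe.1 ((stub_logLinearisation m u v hu0 hv0 ξ hξ l).2 hl).1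
  obtain ⟨k, hkA, hkm, hks⟩ := exists_multiset_of_mem_support_tailDiff u v A (fun j => (hu j).2) (fun j => (hv j).2) l hlT
  have hk0 : k ≠ 0 := by
    rintro rfl
    rw [Multiset.sum_zero] at hks
    rw [← hks, logDiff_zero] at hlD
    exact hlD rfl
  have hkmB : ∀ B, Multiset.card (k.filter (fun e => blk e = B)) ≤ m := fun B =>
    (Multiset.card_le_card (Multiset.filter_le _ _)).trans hkm
  have hL1 := expTensorCoeff_holds m b u v A blk hu hv hG k hkA hkmB hk0
  rw [hks] at hL1
  have hlW : coeff l (expTensor blk u v) ≠ 0 := by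
    intro h
    rw [h, mul_zero] at hL1
    exact hlD hL1
  -- (b) every support point of `𝒲` lies in the log-support
  have hWsub : ∀ p ∈ (expTensor blk u v).support, logDiff u v p ≠ 0 := by
    intro p hp
    obtain ⟨k', hk'A, hk'm, hk's, hk'0⟩ := exists_multiset_of_mem_support_expTensor blk u v A hu hv p hp
    have h := expTensorCoeff_holds m b u v A blk hu hv hG k' hk'A hk'm hk'0
    rw [hk's] at h
    rw [h]
    refine mul_ne_zero (mul_ne_zero (pow_ne_zero _ (by norm_num)) ?_) (mem_support_iff.1 hp)
    exact_mod_cast (Nat.factorial_pos _).ne'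
  -- (c) strict separation
  exact wt_strictTop_mem_extremePoints ξ _ l (mem_support_iff.2 hlW) fun p hp hpl => hl.2 p (hWsub p hp) hpl

/-- ★ **K10 COROLLARY OF RECORD (unconditional): `BlockGradedQuasiPoly`** — on a `BlockGraded` alphabet with `b` blocks and block frames of size `≤ s`,
every cell family has at most `(s + 2) · (8 (2m + 2)^3)^⌈log₂ b⌉` points (val-idea-37 g2's target; = `blockGradedQuasiPoly_of` L2 L3, with Theorem Q
`dissociated_quasiPoly` of stmt-5905's line doing the count).  HONEST LABEL: proper positive sub-case (block-GRADED); the shallow hypothesis is NOT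
claimed; 5906 / 5905 OPEN; VP ≠ VNP NOT proved. [folklore] -/
theorem blockGradedQuasiPoly_holds : BlockGradedQuasiPoly :=
  blockGradedQuasiPoly_of expTensorVisible_holds expTensorFrames_holds

end Summit.ValiantsHypothesis.ValiantsHypothesis.Theorems.NewtonUnitEquations.TwoProducts.ExpBlock

end
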